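import Literature.NumberTheory.EllipticCurves.CastellaWan2024.GreenbergMainConjectureBDP
import Literature.NumberTheory.EllipticCurves.BertoliniLongoVenerucci2026.DefiniteGrossPeriodSelmer
import HarnessLib

/-!
# Bertolini–Longo–Venerucci 2026, Thm. A (IAMC, indefinite, good supersingular, non-exceptional)
# read through Castella–Wan 2024, Thm. 6.8: the EISENSTEIN half of the Iwasawa–Greenberg (BDP)
# anticyclotomic main conjecture `char_{Λac}(X^{rel,str})Λ^ur ⊂ (L_p^BDP)` up to a power of `p`,
# at `N⁻ = 1` under Hypothesis 1.1 — ONE statement-only named fact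

Topic `Literature/NumberTheory/EllipticCurves`; namespace
`Literature.NumberTheory.EllipticCurves.BertoliniLongoVenerucci2026` (sibling of
`DefiniteGrossPeriodSelmer.lean`, which vendors Thm. B of the same paper and whose module docstring
quotes Hypothesis 1.1 verbatim). HONEST FRAMING: a `def … : Prop` (D-0014; nothing asserted, no
`_holds`, no `sorry`), hypotheses AS PRINTED with the restrictions (R1)–(R6) below — each making the
typed statement WEAKER than print —, page locators on the arXiv text `paper:arxiv-2306.17784`
(arXiv v1 chunks `pNNNN`; the published = v2 sentence of Step 4 quoted below) and on Castella–Wan's accepted MS `paper:url-7157bd4f7b88` ("MS p."); the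
conclusion is written in EXACTLY the currency of the tree's
`CastellaWan2024.thm53_exists_isCWBDPLFunction_charIdeal_map_le` (Castella–Wan Thm. 5.3, the same
divisibility at square-free `N` with a non-split prime), so that consumers of that fact can consume
this one verbatim. Typed ≠ proved ≠ endorsed; BSD is not advanced by this file.

WHY (consumer by name). The BSD summit's route `SignedBaseChange`, crux
`AnticyclotomicEisensteinDivisibility` (stmt-BirchSwinnertonDyer-20727), line `bdpline`, registered
stub `stub_bdpLowerHalfRatSS` = the RATIONAL Eisenstein half of the BDP anticyclotomic main
conjecture at a good supersingular `p ≥ 5`, `ρ̄` surjective, classical Heegner field (every `ℓ ∣ N`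
split), ANY conductor. In refereed print that half exists at square-free `N` with a non-split prime
(Castella–Wan Thm. 5.3 ⟸ [CLW22]) — excluded by the crux's field — and, through the two results read
here, on the sub-cell "every bad prime `q` of `E` has `H⁰(I_q, E[p]) = 0`" (for `p ≥ 5`: every bad
prime ADDITIVE) with `p ∤ h_K` (crux idea card `Ideas/primkoly.md` v2.2 §B6, v2.3 §B7). This file
gives that printed chain a Lean NAME; the crux-side glue lives under `Summits/`.

## Sources, VERBATIM (locators)

* [BertoliniLongoVenerucci2026] M. Bertolini, M. Longo, R. Venerucci, *The anticyclotomic main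
  conjectures for elliptic curves*, Math. Ann. (2026), doi:10.1007/s00208-026-03381-0 =
  arXiv:2306.17784 [BertoliniLongoVenerucci2023]. **Hypothesis 1.1** [p0003 L10–L20] (quoted in full
  in `DefiniteGrossPeriodSelmer.lean`): `p ⩾ 5`, `p ∤ N·h_K`; `ρ̄_{E,p}` irreducible; `N⁻`
  squarefree; (ordinary clause); "If `q` is a prime dividing `N⁺`, then `H⁰(I_{ℚ_q}, E_p) = 0`";
  (clause at `q ∥ N⁻`); [p0003 L8] "`N` … assumed to be coprime with the discriminant of `K`.
  Factor `N` as `N = N⁺N⁻`, where `N⁺` resp. `N⁻` is divisible only by primes which are split, resp.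
  inert in `K`". **Def. 1.2** [p0003 L28]: "`(E,K,p,ε)` is exceptional if `E` has supersingular
  reduction at `p`, `p` is inert in `K` and `ε = +`." **Theorem A (DAMC & IAMC)** [p0003 L35–L36]:
  "`(L_p^ε(f)) ⊆ (Char_p^ε(f))` with equality in the non-exceptional case." Indefinite case [p0002
  L8–L10]: "a norm-compatible sequence of Heegner points arising from a Shimura curve
  parametrisation is defined over the finite layers of `K_∞/K`. Its position in the compact `p`-adic
  Selmer group of `E/K_∞` is encoded by an element `L_p(f)` of the anticyclotomic Iwasawa algebra
  `Λ` … The indefinite anticyclotomic Iwasawa Main conjecture (IAMC), formulated by Perrin-Riou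
  [PR-Heeg], states that `L_p(f)` generates the square-root of the characteristic ideal of the
  `Λ`-torsion part of the Pontrjagin dual of the `p`-primary Selmer group of `E/K_∞`."
  **Def. 8.3** [p0037 L17–L26]: "Let `L_p^ε(f)` denote the characteristic power series of
  `𝔖el(K, 𝐓_f)/Λ·κ_∞^ε`. Let `𝔛_p^ε(f)` be the Pontryagin dual of `Sel_ε(K, 𝐀_f)`. Then the compact
  `Λ`-module `𝔛_p^ε(f)` is pseudo-isomorphic to `Λ ⊕ 𝔐 ⊕ 𝔐` for a torsion `Λ`-module `𝔐` …; this
  follows from Theorem (BSD-Indef), the structure results in Step 5 of the proof of Theorem (BSD0),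
  and Proposition (global control)." **Def. 8.4** [p0037 L28–L30]: "Let `Char_p^ε(f)` be the
  characteristic ideal of the `Λ`-module `𝔐`." §5.2.5 [p0017 L28–L60] (the `ε`-Selmer groups:
  "`ε`-finite at primes dividing `p`; … trivial at primes dividing `SN⁺`; finite outside `SLNp`"),
  §8.1 [p0035 L20 ff.] (the `Λ`-adic classes `κ_∞^ε` from Heegner points on the Shimura curve
  `X_{N⁺,N⁻}`, here `X_{N,1} = X₀(N)`), [p0024 L6] "`κ̃_n(L) = ω̃_n^{-ε} κ̄_n^ε(L)`". PROOF
  STRUCTURE [p0028 L2–L6]: "Steps 1, 2 and 3 consist in a generalization … of [Be-Da-main]. … only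
  allow to prove the inequality `length(Sel_ε(K,A_g(χ))) ⩽ 2 ord_χ(𝓛_g^ε(χ̄))` … We can prove the
  opposite inequality in the non-exceptional case with a further inductive argument … The key
  ingredient is Step 4 … which combines Gross formula and Lemma (nonexcss) with results of
  Skinner-Urban (ordinary case) and Wan (supersingular case)"; Step 4 [arXiv v1, p0031 L78–L84]: "Results of
  Skinner–Urban–Wan ([S-U] and Theorem B of [Sk] in the ordinary case, [Wan1] and [Wan2] in the
  supersingular case) prove the inequality `ord_𝔓(L(ξ/K,1)_alg) ⩽ length Sel_{𝔓^∞}(J_ξ/K) +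
  Σ_{q∣NL} t_ξ(q)`"; PUBLISHED TEXT (= arXiv v2, TeX held at
  `run/shared/lean/b2b/bsd-rank1-residual/b2b-bsdres-x9/g26/BLV_arxiv_v2_revision.tex` L3040–L3047):
  "Results of Skinner--Urban and Fouquet--Wan prove the inequality … See [S-U] in the ordinary case;
  for the non-ordinary case, the reader is referred to [FW, Corollaries 1.9, 1.10] and also [BSTW,
  Theorems 1.5, 1.6], [CCSS, Theorem C]"; [p0031 L91] "`t_ξ(q) = 0` for every prime `q ∣ N⁺` under
  our assumptions".
* [CastellaWan2023] F. Castella, X. Wan, *Perrin-Riou's main conjecture for elliptic curves at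
  supersingular primes*, Math. Ann. 389 (2024) 2595–2636 (accepted MS `paper:url-7157bd4f7b88`).
  **Conj. 4.8** (MS p. 22): "(1) `z^±_∞` is not `Λ^ac`-torsion. (2) `Sel_±(K, 𝐓^ac)` and `X_±` have
  `Λ^ac`-rank one. (3) `char_{Λac}(X_{±,tors}) = char_{Λac}(Sel_±(K, 𝐓^ac)/Λ^ac z^±_∞)²`";
  **5.2** (MS p. 23): "`X^{rel,str}` is `Λ^ac`-torsion, and `char_{Λac}(X^{rel,str})Λ^ur = (L_p^BDP)`";
  **Thm. 6.8** (MS p. 29): "Conjectures 4.8 and 5.2 are equivalent. More precisely, (i) … (ii) …; the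
  same result holds for the opposite divisibilities" (proof MS pp. 29–31, (6.12)–(6.16)); **Cor. 6.4**
  (MS p. 27): "The class `loc_𝔭(z^±_∞)` is not `Λ^ac`-torsion"; Prop. 4.4 / Def. 4.5 (MS pp. 20–21:
  `ω̃^{−ε}_n(Y) z_n^ε = Cor_n(z[p^{n+1}])`, `z^ε_∞ = {z_n^ε}_n`); Prop. 2.1 / (2.2) (MS pp. 5–8:
  `L_p^BDP = (𝓛_𝔭^BDP)²`); Def. 5.1 (MS p. 23: `Sel^{rel,str}`).

## The COMBINED READING typed here (two refereed sources; one chain)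

(1) BLV Thm. A, indefinite case, non-exceptional (`p` split), with Def. 8.3/8.4: `char_Λ(𝔐) =
(char. power series of 𝔖el^ε(K, 𝐓_f)/Λκ_∞^ε)`, `𝔛_p^ε(f) ∼ Λ ⊕ 𝔐 ⊕ 𝔐` — i.e. Perrin-Riou's
Heegner point main conjecture for the `ε`-objects: `char_Λ(𝔛_tors) = char_Λ(𝔖el^ε/Λκ_∞^ε)²`,
`rank_Λ 𝔛 = 1`. (2) This IS Castella–Wan's Conj. 4.8 (2)–(3) for `(E, K, p, ε)` [READING FLAG
`BLV-CW-objects`: BLV's `𝔖el^ε(K, 𝐓_f)` / `Sel_ε(K, 𝐀_f)` (§5.2.5: Kobayashi `ε`-finite condition at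
`𝔭 ∣ p` via Prop. 5.3, trivial at `N⁺`, finite elsewhere) and Castella–Wan's `Sel_±(K, 𝐓^ac)` /
`X_±` (Def. 4.6: `±` at `v ∣ p`, relaxed/strict at `v ∤ p`, §4.2) are the compact/discrete signed
anticyclotomic Selmer modules of `E` over `K_∞`; their local conditions at the finitely many `v ∤ p`
differ by `Λ`-modules of `μ`-type (induced from finite groups), invisible in the RATIONAL form typed
below; BLV's `κ_∞^ε` (§8.1, `κ̃_n = ω̃_n^{−ε} κ̄_n^ε`, Heegner points of `p`-power conductor on
`X₀(N)` under the modular parametrisation) and Castella–Wan's `z^ε_∞` (Prop. 4.4: `ω̃^{−ε}_n(Y) z_n^ε =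
Cor_n(z[p^{n+1}])`) are the same construction up to a unit of `Λ` and an integer (a power of `p` in
`Λ`), again invisible rationally]; Conj. 4.8 (1) is Castella–Wan's Cor. 6.4 (proved, MS p. 27).
(3) Castella–Wan Thm. 6.8 (refereed; "the same result holds for the opposite divisibilities"):
Conj. 4.8 ⟹ 5.2, in particular `char_{Λac}(X^{rel,str})Λ^ur ⊂ (L_p^BDP)`. (4) Tree orientation
EXACTLY as restriction (R5) of `CastellaWan2024/GreenbergMainConjectureBDP.lean` (flag
`CW24-53-orientation-L33`): the typed `L` is `ι_Λ(u · L_p^BDP)` characterised by `IsCWBDPLFunction ι 𝔭`,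
and its partner is the PRECOMPOSITION dual `AcSelmer.XAc (W⁄K) p κ 𝔭̄ ∅ γ` (strict at `𝔭̄ ∋ p`,
`𝔭̄ ≠ 𝔭`), = Def. 5.1's `X^{rel,str}` by Shapiro.

## RESTRICTIONS of the transcription (each makes the typed statement WEAKER than print)

(R1) `p` good SUPERSINGULAR with `a_p = 0`, `5 ≤ p`, and `p = 𝔭𝔭̄` SPLIT in `K` (the
non-exceptional supersingular case; Hyp. 1.1's ordinary clause is then vacuous).
-- TODO(general form): `p` inert with `ε = −`; good ordinary `p` (`ε = ∅`, `a_p ≢ ±1`).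
(R2) `N⁻ = 1`: EVERY prime `ℓ ∣ N` has two primes of `K` above it (`N = N⁺`, all split; then
"`N⁻` squarefree", the `q ∥ N⁻` clause and (gen-H) are vacuous, `X_{N⁺,N⁻} = X₀(N)`); `(N, D_K) = 1`
kept verbatim. -- TODO(general form): `N⁻ ≠ 1` with an even number of inert primes.
(R3) `ρ̄_{E,p}` SURJECTIVE (`Rank1Residual.Surj`), stronger than Hyp. 1.1's "irreducible" (the
level-raising Hypothesis 3.2 [p0008 L92–L98] and Pollack–Weston's CR [p0010 L44–L48] are printed
with surjectivity; flag RF1 of `DefiniteGrossPeriodSelmer.lean`).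
(R4) Hyp. 1.1, bullet 5, VERBATIM and in the same Lean currency as `DefiniteGrossPeriodSelmer.lean`:
for every prime `q ∣ N`, every prime `𝔓` of `ℤ̄` above `q` and every `P ∈ E[p]` fixed by the inertia
group `𝔓.inertia Γ_ℚ`: `P = 0`. (For `p ≥ 5` this holds iff `q` is a prime of ADDITIVE reduction —
Kodaira–Néron index `≤ 4`, Serre–Tate —, and fails at every multiplicative `q` by the Tate curve;
the discharge is the consumer's job, not this file's.)
(R5) `p ∤ h_K` verbatim (`NumberField.classNumber`); `κ` the anticyclotomic `ℤ_p`-extension with a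
topological generator `γ`; `𝔭` the prime induced by the embedding datum `ι` (binder as in the
Castella–Wan facts); `W` a global minimal model with newform `f` of level `N = N_E`.
(R6) CONCLUSION in RATIONAL form and with an EXISTENTIAL frame, byte-parallel to
`CastellaWan2024.charIdeal_map_le_rat_of_thm53`: there is a frame `(Ω_K ≠ 0, Ω_p ∈ R₀ˣ, L ∈ R₀⟦T⟧)`
with `IsCWBDPLFunction ι 𝔭 κ γ f D_K Ω_K Ω_p L` such that along every structure map `j : ℤ_p → R₀`
compatible with `ℤ_p ⊂ ℂ_p` there is `k` with `p^k · char_Λ(X_ac strict at 𝔭̄)·R₀⟦T⟧ ⊆ (L)`. Print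
gives the INTEGRAL equality `char_{Λac}(X^{rel,str})Λ^ur = (L_p^BDP)` and the torsion of `X^{rel,str}`;
neither is recorded (the `p^k` absorbs the normalisations of flag `BLV-CW-objects`; torsion of
`X_ac` on this cell is available from refereed sources already typed in the tree, Longo–Vigni 2019
Thm. 1.4 + Castella–Wan Thm. 6.8).

## READING / RELIABILITY FLAGS (informational; for graders of results routed through this fact)

* `BLV-step4-UNSOURCED-on-R4` (supersedes this file's first version's `BLV-step4-Wan`; readers: crux
  idea card `Ideas/primkoly.md` v2.4 §B8(i)–(iv), v2.5 §B8(v), critic idea-crit-15 V#19/V#19b,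
  2026-08-28): in the supersingular case Step 4 of BLV's proof of Thm. 7.1 (the base of the induction
  giving the OPPOSITE inequality, hence the Eisenstein half typed here) is the rank-`0` inequality
  `ord_𝔓 L(ξ/K,1)_alg ≤ length Sel + Σ t_ξ(q)` for the level-raised weight-2 forms `ξ` of level `N·L`.
  The arXiv v1 text sourced it from X. Wan, arXiv:1411.6352 / arXiv:1607.07729 (withdrawn as proofs,
  BSTW Rem. 1.4 (i)); the PUBLISHED text sources it from Fouquet–Wan arXiv:2107.13726 Cor. 1.9/1.10
  (of Thm. 1.7: needs a prime `ℓ ∤ p` at which `ρ̄|_{G_{ℚ_ℓ}}` is a RAMIFIED extension of `μχ^{−k/2}` by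
  `μχ^{1−k/2}` with `μ` the non-trivial unramified quadratic character — a Steinberg-type prime),
  Burungale–Skinner–Tian–Wan arXiv:2409.01350 Thms. 1.5/1.6 and Castella–Çiperiani–Skinner–Sprung
  arXiv:1804.10993 Thm. C (both for SEMISTABLE curves). On this fact's OWN typed domain (R4): every
  `q ∣ N` additive (no multiplicative, hence no Steinberg prime; the level-raising primes `ℓ ∣ L` are
  `ρ̄`-unramified), NONE of the three published Step-4 sources applies. The source is a refereed
  journal theorem and is cited as such, but consumers must BOOK any result routed through this fact on
  the all-additive cell as resting on an UNSOURCED step of the printed proof — the rank-`0` Eisenstein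
  `p`-converse / `p`-BSD inequality for the level-raised `J_ξ`, i.e. research-grade input "K1" of the
  crux idea card — and NOT as print; the booking grade is a director/planner ruling, not this file's.
* `BLV-sec3-squarefree` (= RF1 of `DefiniteGrossPeriodSelmer.lean`): §3 of the arXiv text opens
  "Fix a squarefree positive integer `N`" [p0008 L3] while Thm. A is stated under Hyp. 1.1 (`N⁺`
  arbitrary subject to bullet 5); §4.1 invokes [P-W] Thm. 6.2 / Prop. 6.5 at arbitrary `N⁺`
  [p0010 L44–L48]. The journal text is requested for comparison (acquisition queue, sibling file).
* `BLV-CW-objects`: the identification (2) above; `CW24-53-orientation-L33`, `CW24-local-condition`,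
  `dual-convention`, `heegner-normalisation`: inherited from the Castella–Wan files.

## NOT typed here (and why)

BLV's own objects (`𝔖el^ε(K, 𝐓_f)`, `κ_∞^ε`, `𝔐`) as tree carriers — the tree's signed carriers are
Castella–Wan's (`AcSigned.selmerLambdaAdic`, `AcSigned.X`), and the statement in THAT currency needs
either the involution symmetry of `char(X_{ε,tors})` or a pinned version of
`AcSigned.castellaWan2024_proofThm68_transferInputs` (neither in the tree); the BDP currency of
Castella–Wan Thm. 6.8 (ii) avoids both. Theorems B/C (finite layers), the definite case, the
exceptional case, the inert non-exceptional case, `N⁻ ≠ 1`: not needed by the consumer.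
-/

noncomputable section

open scoped NumberField
open NumberField IsDedekindDomain Field
open Literature.NumberTheory.EllipticCurves Literature.NumberTheory.EllipticCurves.ModularForms
  Literature.NumberTheory.EllipticCurves.Rank1Residual Literature.NumberTheory.EllipticCurves.Castella2018
  Literature.NumberTheory.EllipticCurves.CastellaWan2024 Literature.NumberTheory.GaloisRepresentations

namespace Literature.NumberTheory.EllipticCurves.BertoliniLongoVenerucci2026

/-- **Bertolini–Longo–Venerucci 2026, Thm. A (IAMC, indefinite, good supersingular `p ≥ 5` split in
`K`, `N⁻ = 1`, Hypothesis 1.1) read through Castella–Wan 2024, Thm. 6.8: the Eisenstein half of the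
Iwasawa–Greenberg (BDP) anticyclotomic statement 5.2 of Castella–Wan, `char_{Λac}(X^{rel,str})Λ^ur ⊂
(L_p^BDP)`, UP TO A POWER OF `p`.** Printed: BLV Thm. A "`(L_p^ε(f)) ⊆ (Char_p^ε(f))` with equality in the
non-exceptional case" with Def. 8.3/8.4 (indefinite: `L_p^ε(f)` = char. power series of
`𝔖el^ε(K,𝐓_f)/Λκ_∞^ε`, `𝔛_p^ε(f) ∼ Λ ⊕ 𝔐 ⊕ 𝔐`, `Char_p^ε(f) = char(𝔐)`) = Castella–Wan's statement
4.8 for `(E,K,p,ε)` (with Cor. 6.4 for its clause (1)); Castella–Wan Thm. 6.8 "[4.8] and [5.2] are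
equivalent … the same result holds for the opposite divisibilities", 5.2 = "`X^{rel,str}` is
`Λ^ac`-torsion, and `char_{Λac}(X^{rel,str})Λ^ur = (L_p^BDP)`". TYPED (module docstring: combined
reading (1)–(4), restrictions (R1)–(R6) each WEAKER than print, flags `BLV-step4-UNSOURCED-on-R4`,
`BLV-sec3-squarefree`, `BLV-CW-objects`): `W/ℚ` globally minimal elliptic with newform `f` of level
`N = N_E`; `5 ≤ p` good with `a_p = 0` (R1); `ρ̄_{E,p}` surjective (R3); `K` imaginary quadratic,
`p = 𝔭𝔭̄` split with `𝔭` the prime of the embedding datum `ι`, `𝔭̄ ∋ p`, `𝔭̄ ≠ 𝔭`; EVERY prime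
`ℓ ∣ N` split in `K` (R2), `(N, D_K) = 1`, `p ∤ h_K` (R5); Hyp. 1.1 bullet 5 VERBATIM: for every prime
`q ∣ N`, prime `𝔓 ∣ q` of `ℤ̄` and `P ∈ E[p]` fixed by `𝔓.inertia Γ_ℚ`, `P = 0` (R4); `κ`
anticyclotomic with topological generator `γ`. CONCLUSION (R6, the currency of
`CastellaWan2024.charIdeal_map_le_rat_of_thm53` VERBATIM): a frame `(Ω_K ≠ 0, Ω_p ∈ R₀ˣ, L ∈ R₀⟦T⟧)`
with `IsCWBDPLFunction ι 𝔭 κ γ f D_K Ω_K Ω_p L` such that along every structure map `j : ℤ_p → R₀`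
compatible with `ℤ_p ⊂ ℂ_p` there is `k : ℕ` with `(p^k) · char_Λ(X_ac)·R₀⟦T⟧ ⊆ (L)`,
`X_ac = AcSelmer.XAc (W⁄K) p κ 𝔭̄ ∅ γ` (= `X^{rel,str}`, flag `CW24-53-orientation-L33`). A chain of
two PUBLISHED, refereed results typed as ONE named fact; flag `BLV-step4-UNSOURCED-on-R4` (module
docstring) records that on this fact's own domain (every `q ∣ N` additive) the published proof's
Step 4 — the rank-`0` inequality for the level-raised forms — has NO applicable citation (Fouquet–Wan
Cor. 1.9/1.10 needs a Steinberg-type prime; BSTW Thms. 1.5/1.6 and CÇSS Thm. C are semistable), so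
results through this fact are to be BOOKED as resting on that unsourced step, not as print. No
`_holds` expected; consumers take `(h : thmA_castellaWan_thm68_exists_isCWBDPLFunction_charIdeal_map_le_rat)`.
-- TODO(general form): the integral equality and the torsion clause of 5.2; `p` inert with `ε = −`; `N⁻ ≠ 1`.
[cite: BertoliniLongoVenerucci2026, Thm. A with Hyp. 1.1, Def. 1.2, Def. 8.3–8.4, §5.2.5, §8.1, §7.2 Steps 1–4 (arXiv:2306.17784 p0003, p0037, p0017, p0035, p0028, p0031)]
[cite: BertoliniLongoVenerucci2023, Thm. A]
[cite: CastellaWan2023, Thm. 6.8 and its proof (MS pp. 29–31), Conj. 4.8 (MS p. 22), 5.2 and Def. 5.1 (MS p. 23), Cor. 6.4 (MS p. 27), Prop. 4.4 / Def. 4.5 (MS pp. 20–21), Prop. 2.1 and (2.2) (MS pp. 5–8)]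
[cite: Castella2018, Def. 2.2 (the tree object `AcSelmer.XAc`)] -/
def thmA_castellaWan_thm68_exists_isCWBDPLFunction_charIdeal_map_le_rat : Prop :=
  ∀ {p : ℕ} [Fact p.Prime] (ι : PadicAlgCl p ≃+* ℂ) (W : WeierstrassCurve ℚ) [W.IsElliptic]
    [W.IsGloballyMinimal] (K : Type) [Field K] [NumberField K]
    (𝔭 𝔭bar : HeightOneSpectrum (𝓞 K)) (κ : ZpExtension K p) (γ : absoluteGaloisGroup K)
    [Fact (κ.IsTopGenerator γ)] {N : ℕ} [NeZero N] {f : CuspForm (CongruenceSubgroup.Gamma0 N) 2}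
    (_ : IsNewformOf W f),
    -- the conductor; (R1) `p ≥ 5` good supersingular with `a_p = 0`; (R3) `ρ̄_{E,p}` surjective
    (N : ℤ) = W.conductorNorm ℤ → 5 ≤ p → W.HasGoodReductionAtPrime p → W.frobeniusTrace p = 0 →
    Surj W p →
    -- `K` imaginary quadratic; `p = 𝔭𝔭̄` split, `𝔭` induced by `ι`
    IsImaginaryQuadratic K → ((Ideal.span {(p : ℤ)}).primesOver (𝓞 K)).ncard = 2 →
      ((p : ℕ) : 𝓞 K) ∈ 𝔭.asIdeal →
      (∀ (w : InfinitePlace K) (k : 𝓞 K), k ∈ 𝔭.asIdeal ↔ ‖ι.symm (w.embedding (k : K))‖ < 1) →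
      ((p : ℕ) : 𝓞 K) ∈ 𝔭bar.asIdeal → 𝔭bar ≠ 𝔭 →
    -- (R2) `N⁻ = 1`: every `ℓ ∣ N` split in `K`; `(N, D_K) = 1`; (R5) `p ∤ h_K`
    (∀ ℓ : ℕ, ℓ.Prime → ℓ ∣ N → ((Ideal.span {(ℓ : ℤ)}).primesOver (𝓞 K)).ncard = 2) →
    IsCoprime (N : ℤ) (NumberField.discr K) → ¬ p ∣ NumberField.classNumber K →
    -- (R4) Hypothesis 1.1, bullet 5, VERBATIM: `H⁰(I_{ℚ_q}, E[p]) = 0` for every prime `q ∣ N = N⁺`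
    (∀ q : ℕ, q.Prime → q ∣ N → ∀ v : HeightOneSpectrum (𝓞 ℚ), ((q : ℕ) : 𝓞 ℚ) ∈ v.asIdeal →
      ∀ 𝔓 ∈ v.primesAbove, ∀ P : W.geomTorsion (p : ℤ),
        (∀ σ ∈ 𝔓.inertia (absoluteGaloisGroup ℚ), σ • P = P) → P = 0) →
    -- the anticyclotomic tower
    κ.IsAnticyclotomic →
    ∃ (ΩK : ℂ) (Ωp : (unrIntegers p)ˣ) (L : UnrSeries p),
      ΩK ≠ 0 ∧
      IsCWBDPLFunction ι 𝔭 κ γ f (NumberField.discr K) ΩK ((Ωp : unrIntegers p) : ℂ_[p]) L ∧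
      ∀ (j : ℤ_[p] →+* unrIntegers p),
        (∀ x : ℤ_[p], ((j x : unrIntegers p) : ℂ_[p]) = algebraMap ℚ_[p] ℂ_[p] (x : ℚ_[p])) →
        ∃ k : ℕ,
          Ideal.span {PowerSeries.C ((p : unrIntegers p) ^ k)} *
              (AcSelmer.XAc.charIdeal (W.baseChange K) p κ 𝔭bar ∅ γ).map (PowerSeries.map j) ≤
            Ideal.span {L}

end Literature.NumberTheory.EllipticCurves.BertoliniLongoVenerucci2026

end
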